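import Mathlib.RingTheory.MvPolynomial.WeightedHomogeneous
import Mathlib.Algebra.MvPolynomial.Division
import Mathlib.RingTheory.Localization.Away.Basic
import Mathlib.RingTheory.Localization.AtPrime.Basic
import Mathlib.RingTheory.Ideal.Quotient.Operations
import Literature.AlgebraicGeometry.Resolution.AffineBlowupAlgebra
import Summits.ResolutionOfSingularities.ResolutionOfSingularities.Theorems.FrobeniusLadderFInjectiveMacaulayficationWeightedChartImage
import Summits.ResolutionOfSingularities.ResolutionOfSingularities.Theorems.FrobeniusLadderFInjectiveMacaulayficationWeightedChartInjective
import Summits.ResolutionOfSingularities.ResolutionOfSingularities.Theorems.FrobeniusLadderFInjectiveMacaulayficationE8Char5FiModel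
import Summits.ResolutionOfSingularities.ResolutionOfSingularities.Theorems.FrobeniusLadderFInjectiveMacaulayficationWeightedChartMap
import Summits.ResolutionOfSingularities.ResolutionOfSingularities.Theorems.FrobeniusLadderFInjectiveMacaulayficationWeightZeroClauseDescent
import HarnessLib

/-!
# The weighted blow-up chart ring is the weight-`0̄` subalgebra: transport of the clause
(crux `FInjectiveMacaulayfication`, line `Sketch`, §15 weighted cone engine, stub #22 `stub_weightedChartClause`)

Support file for crux stmt-ResolutionOfSingularities-15315 (`FrobeniusLadder.FInjectiveMacaulayfication`, line
`Sketch`), registered stub `stub_weightedChartClause` (#22 of skeleton 10f06f91). [OURS · L1 W4.5a] — a statement about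
OUR route's weighted cone engine, not a statement of any manuscript.

Setting: `k` a field of characteristic `p`, `P = k[X₀,…,X_{n-1}]`, weights `w`, chart index `v` (`0 < w_v`),
`N = c w_v`, `I_N` = monomials of weighted degree `≥ N` (Veronese-saturated), `θ_v` the root-cover substitution
(`X_v ↦ X_v^{w_v}`, `X_j ↦ X_j X_v^{w_j}`), `θ_v f = X_v^D g` with `g` weighted homogeneous of degree `-D` for
`W = (X_v ↦ 1, X_j ↦ -w_j)` (values in `ℤ/w_v`) and `X_v ∤ g`.

* `exists_ringEquiv_of_image_eq` — abstract: two embedded subalgebras with the same image under injective ring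
  maps are ring-isomorphic over the common target.
* `algebraMap_away_injective_of_not_dvd` — `P/(g) → (P/(g))[1/x_v]` is injective (`X_v ∤ g`, `X_v` prime).
* `exists_chartEquiv` — THE CHART IDENTIFICATION: the affine blow-up algebra `(P/(f))[I_N/x_v^c]` is ring-isomorphic
  to the weight-`0̄` subalgebra `A ⊆ P/(g)`, compatibly with the chart map `Θ` (#20 `stub_weightedChartInjective`:
  `Θ` injective; #21 `stub_weightedChartImage`: `Θ` maps the chart ring onto the image of `A`), and the marked
  element `x_v^c` goes to `x_v^N`.
* `stub_weightedChartClause` — THE REGISTERED STUB: if `P/(g)` satisfies the Cohen–Macaulay + Frobenius-closed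
  clause at every maximal ideal containing `x_v`, the chart ring satisfies it at every maximal ideal containing
  `x_v^c`. Assembly of landed pieces: the chart map exists (`WeightedChartMap.exists_chartMap`, helper of #20/#21);
  the clause descends from `P/(g)` to `A` at maximal ideals containing `x_v^N`
  (`WeightZeroClauseDescent.weightZero_clause_descent` = retraction #8 + component rule #19 + integrality #12 +
  local dimensions #10/#11 + finite graded descent #9); transport along `exists_chartEquiv`
  (`E8Char5FiModel.clause_maximal_of_ringEquiv`). The hypothesis `x_v ≠ 0 in P/(f)` of the registered signature is
  idle.

All proofs are glue; no definitions, no named facts. [folklore]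

## References

* The Stacks Project, Tag 052Q (affine blow-up algebra). [StacksProject]
* M. Reid, *Young person's guide to canonical singularities* (1987), §4 (weighted blow-ups as quotients of the
  root cover by `μ_r`; the chart ring = the invariant = degree-`0̄` subring); folklore.
-/

-- single-problem summit: the doubled namespace component is forced
set_option linter.dupNamespace false

noncomputable section

namespace Summit.ResolutionOfSingularities.ResolutionOfSingularities.Theorems.FInjectiveMacaulayfication.WeightedChartClause

open MvPolynomial Literature.AlgebraicGeometry.Resolution
open Summit.ResolutionOfSingularities.ResolutionOfSingularities.Theorems.FInjectiveMacaulayfication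

/-- If `X_v ∤ g` then `g ∣ q · X_v^m` forces `g ∣ q` (`X_v` is a prime element of `k[X]`). [folklore] -/
theorem dvd_of_dvd_mul_X_pow (k : Type) [Field k] (n : ℕ) (v : Fin n) (g : MvPolynomial (Fin n) k)
    (hXg : ¬ (MvPolynomial.X v : MvPolynomial (Fin n) k) ∣ g) :
    ∀ (m : ℕ) (q : MvPolynomial (Fin n) k), g ∣ q * MvPolynomial.X v ^ m → g ∣ q := by
  intro m
  induction m with
  | zero =>
    intro q h
    simpa using h
  | succ m ih =>
    rintro q ⟨h, hh⟩
    have hX : (X v : MvPolynomial (Fin n) k) ∣ g * h := ⟨q * X v ^ m, by rw [← hh]; ring⟩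
    rcases MvPolynomial.X_dvd_mul_iff.mp hX with hXg' | ⟨h', rfl⟩
    · exact absurd hXg' hXg
    · refine ih q ⟨h', mul_right_cancel₀ (MvPolynomial.X_ne_zero v) ?_⟩
      calc q * X v ^ m * X v = q * X v ^ (m + 1) := by ring
        _ = g * (X v * h') := hh
        _ = g * h' * X v := by ring

/-- **`k[X]/(g) → (k[X]/(g))[1/x_v]` is injective when `X_v ∤ g`**: the class `x_v` of `X_v` (and its powers) is
a non-zero-divisor modulo `g`. [folklore] -/
theorem algebraMap_away_injective_of_not_dvd (k : Type) [Field k] (n : ℕ) (v : Fin n)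
    (g : MvPolynomial (Fin n) k) (hXg : ¬ (MvPolynomial.X v : MvPolynomial (Fin n) k) ∣ g) :
    Function.Injective (algebraMap (MvPolynomial (Fin n) k ⧸ Ideal.span {g})
      (Localization.Away (Ideal.Quotient.mk (Ideal.span {g}) (MvPolynomial.X v)))) := by
  apply IsLocalization.injective (M := Submonoid.powers (Ideal.Quotient.mk (Ideal.span {g}) (MvPolynomial.X v)))
  rintro _ ⟨m, rfl⟩
  rw [mem_nonZeroDivisors_iff_right]
  intro y hy
  obtain ⟨q, rfl⟩ := Ideal.Quotient.mk_surjective y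
  dsimp only at hy
  rw [← map_pow, ← map_mul, Ideal.Quotient.eq_zero_iff_mem, Ideal.mem_span_singleton] at hy
  rw [Ideal.Quotient.eq_zero_iff_mem, Ideal.mem_span_singleton]
  exact dvd_of_dvd_mul_X_pow k n v g hXg m q hy

/-- **Two embedded subrings with the same image are isomorphic** (abstract form of the chart identification):
`B ⊆ S` an `R`-subalgebra, `A ⊆ T` a `k`-subalgebra, `Θ : S → L` and `ι : T → L` injective ring maps with
`Θ(B) = ι(A)`; then `B ≃+* A` over `L`. (Set-theoretic inverse by choice, a ring map by injectivity of `ι`.) [folklore] -/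
theorem exists_ringEquiv_of_image_eq {R S T L k : Type*} [CommRing R] [CommRing S] [Algebra R S]
    [CommRing T] [CommRing L] [CommRing k] [Algebra k T]
    (B : Subalgebra R S) (A : Subalgebra k T) (Θ : S →+* L) (ι : T →+* L)
    (hΘ : Function.Injective Θ) (hι : Function.Injective ι)
    (h₁ : ∀ z : S, z ∈ B → ∃ x : T, x ∈ A ∧ Θ z = ι x)
    (h₂ : ∀ x : T, x ∈ A → ∃ z : S, z ∈ B ∧ Θ z = ι x) :
    ∃ e : ↥B ≃+* ↥A, ∀ z : ↥B, ι ((e z : ↥A) : T) = Θ (z : S) := by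
  have hF : ∀ z : ↥B, ∃ x : ↥A, ι (x : T) = Θ (z : S) := fun z => by
    obtain ⟨x, hx, hzx⟩ := h₁ z z.2
    exact ⟨⟨x, hx⟩, hzx.symm⟩
  choose F hF using hF
  have hinj' : ∀ a b : ↥A, ι (a : T) = ι (b : T) → a = b := fun a b h => Subtype.ext (hι h)
  have h1 : F 1 = 1 := hinj' _ _ (by rw [hF, Subalgebra.coe_one, Subalgebra.coe_one, map_one, map_one])
  have h0 : F 0 = 0 := hinj' _ _ (by rw [hF, Subalgebra.coe_zero, Subalgebra.coe_zero, map_zero, map_zero])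
  have hmul : ∀ a b, F (a * b) = F a * F b := fun a b => hinj' _ _ (by
    rw [hF, Subalgebra.coe_mul, Subalgebra.coe_mul, map_mul, map_mul, hF, hF])
  have hadd : ∀ a b, F (a + b) = F a + F b := fun a b => hinj' _ _ (by
    rw [hF, Subalgebra.coe_add, Subalgebra.coe_add, map_add, map_add, hF, hF])
  let e₀ : ↥B →+* ↥A :=
    { toFun := F, map_one' := h1, map_mul' := hmul, map_zero' := h0, map_add' := hadd }
  have he₀ : ∀ z, e₀ z = F z := fun z => rfl
  have hinj : Function.Injective e₀ := fun a b h => by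
    apply Subtype.ext
    apply hΘ
    rw [← hF, ← hF, ← he₀, ← he₀, h]
  have hsurj : Function.Surjective e₀ := fun x => by
    obtain ⟨z, hz, hzx⟩ := h₂ x x.2
    exact ⟨⟨z, hz⟩, hinj' _ _ (by rw [he₀, hF, hzx])⟩
  exact ⟨RingEquiv.ofBijective e₀ ⟨hinj, hsurj⟩, fun z => by rw [RingEquiv.ofBijective_apply, he₀, hF]⟩

/-- **THE CHART RING IS THE WEIGHT-`0̄` SUBALGEBRA** (transport datum for `stub_weightedChartClause`): with the
root-cover substitution `θ_v`, `θ_v f = X_v^D g`, `g` weighted homogeneous of degree `-D`, `X_v ∤ g`, and a chart map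
`Θ : (k[X]/(f))[1/x_v^c] → (k[X]/(g))[1/x_v]` compatible with `θ_v`, there is a ring isomorphism
`e : (k[X]/(f))[I_N/x_v^c] ≃+* A` onto the weight-`0̄` subalgebra `A ⊆ k[X]/(g)` lying over `Θ`
(`x ↦ Θ x` on the chart ring, `A ↪ (k[X]/(g))[1/x_v]` on `A`), and it carries the marked element `x_v^c` of the
chart ring to `x_v^N` (`N = c w_v`). Ingredients: `Θ` is injective (`stub_weightedChartInjective`, #20), its image
on the chart ring is exactly the image of `A` (`stub_weightedChartImage`, #21), and `A → (k[X]/(g))[1/x_v]` is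
injective (`algebraMap_away_injective_of_not_dvd`). [folklore] -/
theorem exists_chartEquiv (k : Type) [Field k] (n : ℕ) (w : Fin n → ℕ) (v : Fin n) (hv : 0 < w v)
    (N c D : ℕ) (hcN : c * w v = N) (hc : 0 < c)
    (hsat : ∀ (K : ℕ) (b : Fin n →₀ ℕ), K * N ≤ Finsupp.weight w b →
      (MvPolynomial.monomial b (1 : k) : MvPolynomial (Fin n) k) ∈
        (Ideal.span {m : MvPolynomial (Fin n) k | ∃ b : Fin n →₀ ℕ, N ≤ Finsupp.weight w b ∧
          m = MvPolynomial.monomial b 1}) ^ K)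
    (f g : MvPolynomial (Fin n) k)
    (hθf : MvPolynomial.aeval (fun j : Fin n => if j = v then (MvPolynomial.X v : MvPolynomial (Fin n) k) ^ (w v)
      else MvPolynomial.X j * MvPolynomial.X v ^ (w j)) f = MvPolynomial.X v ^ D * g)
    (hg : MvPolynomial.IsWeightedHomogeneous
      (fun j : Fin n => if j = v then (1 : ZMod (w v)) else -((w j : ℕ) : ZMod (w v))) g (-((D : ℕ) : ZMod (w v))))
    (hXg : ¬ (MvPolynomial.X v : MvPolynomial (Fin n) k) ∣ g)
    (Θ : Localization.Away (Ideal.Quotient.mk (Ideal.span {f}) (MvPolynomial.X v) ^ c) →+*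
      Localization.Away (Ideal.Quotient.mk (Ideal.span {g}) (MvPolynomial.X v)))
    (hΘ : ∀ s : MvPolynomial (Fin n) k,
      Θ (algebraMap (MvPolynomial (Fin n) k ⧸ Ideal.span {f})
        (Localization.Away (Ideal.Quotient.mk (Ideal.span {f}) (MvPolynomial.X v) ^ c))
        (Ideal.Quotient.mk (Ideal.span {f}) s)) =
      algebraMap (MvPolynomial (Fin n) k ⧸ Ideal.span {g})
        (Localization.Away (Ideal.Quotient.mk (Ideal.span {g}) (MvPolynomial.X v)))
        (Ideal.Quotient.mk (Ideal.span {g}) (MvPolynomial.aeval (fun j : Fin n => if j = v then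
          (MvPolynomial.X v : MvPolynomial (Fin n) k) ^ (w v) else MvPolynomial.X j * MvPolynomial.X v ^ (w j)) s)))
    (A : Subalgebra k (MvPolynomial (Fin n) k ⧸ Ideal.span {g}))
    (hA : ∀ b : MvPolynomial (Fin n) k ⧸ Ideal.span {g}, b ∈ A ↔ ∃ U : MvPolynomial (Fin n) k,
      MvPolynomial.IsWeightedHomogeneous
        (fun j : Fin n => if j = v then (1 : ZMod (w v)) else -((w j : ℕ) : ZMod (w v))) U 0 ∧
      Ideal.Quotient.mk (Ideal.span {g}) U = b) :
    ∃ e : ↥(Literature.AlgebraicGeometry.Resolution.blowupAlgebra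
        ((Ideal.span {m : MvPolynomial (Fin n) k | ∃ b : Fin n →₀ ℕ, N ≤ Finsupp.weight w b ∧
          m = MvPolynomial.monomial b 1}).map (Ideal.Quotient.mk (Ideal.span {f})))
        (Ideal.Quotient.mk (Ideal.span {f}) (MvPolynomial.X v) ^ c)) ≃+* ↥A,
      (∀ z, algebraMap (MvPolynomial (Fin n) k ⧸ Ideal.span {g})
          (Localization.Away (Ideal.Quotient.mk (Ideal.span {g}) (MvPolynomial.X v))) ((e z : ↥A) :
            MvPolynomial (Fin n) k ⧸ Ideal.span {g}) =
        Θ (z : Localization.Away (Ideal.Quotient.mk (Ideal.span {f}) (MvPolynomial.X v) ^ c))) ∧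
      ((e (algebraMap (MvPolynomial (Fin n) k ⧸ Ideal.span {f}) _
          (Ideal.Quotient.mk (Ideal.span {f}) (MvPolynomial.X v) ^ c)) : ↥A) :
          MvPolynomial (Fin n) k ⧸ Ideal.span {g}) =
        Ideal.Quotient.mk (Ideal.span {g}) (MvPolynomial.X v) ^ N := by
  -- #20: `Θ` is injective; #21: `Θ (chart ring) = image of A`; `A ↪ (k[X]/(g))[1/x_v]`
  have hΘinj : Function.Injective Θ :=
    WeightedChartInjective.stub_weightedChartInjective k n w v hv N c D hcN hc f g _ rfl hθf hg hXg Θ hΘ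
  have himg := WeightedChartImage.stub_weightedChartImage k n w v hv N c hcN hc hsat f g _ rfl Θ hΘ A hA
  have hιinj := algebraMap_away_injective_of_not_dvd k n v g hXg
  obtain ⟨e, he⟩ := exists_ringEquiv_of_image_eq _ A Θ _ hΘinj hιinj himg.1 himg.2
  refine ⟨e, he, ?_⟩
  -- the marked element: `Θ (x_v^c) = x_v^N`
  apply hιinj
  rw [he, Subalgebra.coe_algebraMap]
  have h3 := hΘ (MvPolynomial.X v ^ c)
  rw [map_pow (MvPolynomial.aeval _), MvPolynomial.aeval_X, if_pos rfl, ← pow_mul, mul_comm, hcN] at h3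
  simp only [map_pow] at h3 ⊢
  exact h3

/-- **`stub_weightedChartClause`** (registered stub #22 of skeleton 10f06f91, line `Sketch` §15 weighted cone
engine): for the root-cover substitution `θ_v` with `θ_v f = X_v^D g`, `g` weighted homogeneous of degree `-D`,
`X_v ∤ g`, Veronese-saturated `I_N` (`N = c w_v`), if `k[X]/(g)` satisfies the Cohen–Macaulay + Frobenius-closed
clause at every maximal ideal containing `x_v`, then the weighted blow-up chart ring `(k[X]/(f))[I_N/x_v^c]`
satisfies it at every maximal ideal containing `x_v^c`. ASSEMBLY: the chart map `Θ` exists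
(`WeightedChartMap.exists_chartMap`); the chart ring is `≃+* A`, the weight-`0̄` subalgebra of `k[X]/(g)`, with
`x_v^c ↦ x_v^N` (`exists_chartEquiv`, from #20 `stub_weightedChartInjective` and #21 `stub_weightedChartImage`); the
clause descends from `k[X]/(g)` to `A` at maximal ideals containing `x_v^N`
(`WeightZeroClauseDescent.weightZero_clause_descent`: retraction #8, integrality #12, dimensions #10/#11, finite
graded descent #9); transport along the ring isomorphism (`E8Char5FiModel.clause_maximal_of_ringEquiv`). [folklore] -/
theorem stub_weightedChartClause : ∀ (p : ℕ) [Fact p.Prime] (k : Type) [Field k] [CharP k p] (n : ℕ) (w : Fin n → ℕ) (v : Fin n), 0 < w v → ∀ (N c D : ℕ), c * w v = N → 0 < c → (∀ (K : ℕ) (b : Fin n →₀ ℕ), K * N ≤ Finsupp.weight w b → (MvPolynomial.monomial b (1 : k) : MvPolynomial (Fin n) k) ∈ (Ideal.span {m : MvPolynomial (Fin n) k | ∃ b : Fin n →₀ ℕ, N ≤ Finsupp.weight w b ∧ m = MvPolynomial.monomial b 1}) ^ K) → ∀ (f g : MvPolynomial (Fin n) k), MvPolynomial.aeval (fun j : Fin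 n => if j = v then (MvPolynomial.X v : MvPolynomial (Fin n) k) ^ (w v) else MvPolynomial.X j * MvPolynomial.X v ^ (w j)) f = MvPolynomial.X v ^ D * g → MvPolynomial.IsWeightedHomogeneous (fun j : Fin n => if j = v then (1 : ZMod (w v)) else -((w j : ℕ) : ZMod (w v))) g (-((D : ℕ) : ZMod (w v))) → ¬ (MvPolynomial.X v : MvPolynomial (Fin n) k) ∣ g → Ideal.Quotient.mk (Ideal.span {f}) (MvPolynomial.X v) ≠ 0 → (∀ (Q : Ideal (MvPolynomial (Fin n) k ⧸ Ideal.span {g})) [Q.IsMaximal], Ideal.Quotient.mk (Ideal.span {g}) (MvPolynomial.X v) ∈ Q → ∀ d : ℕ, ringKrullDim (Localization.AtPrime Q) = d → ∀ s : Fin d → Localization.AtPrime Q, (Ideal.span (Set.range s)).radical.IsMaximal → RingTheory.Sequence.IsWeaklyRegular (Localization.AtPrime Q) (List.ofFn s) ∧ ∀ y : Localization.AtPrime Q, (∃ e : ℕ, y ^ p ^ e ∈ Ideal.span ((fun z : Localization.AtPrime Q => z ^ p ^ e) '' (Ideal.span (Set.range s) : Set (Localization.AtPrime Q)))) → y ∈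 Ideal.span (Set.range s)) → ∀ (Q : Ideal (Literature.AlgebraicGeometry.Resolution.blowupAlgebra ((Ideal.span {m : MvPolynomial (Fin n) k | ∃ b : Fin n →₀ ℕ, N ≤ Finsupp.weight w b ∧ m = MvPolynomial.monomial b 1}).map (Ideal.Quotient.mk (Ideal.span {f}))) (Ideal.Quotient.mk (Ideal.span {f}) (MvPolynomial.X v) ^ c))) [Q.IsMaximal], algebraMap (MvPolynomial (Fin n) k ⧸ Ideal.span {f}) (Literature.AlgebraicGeometry.Resolution.blowupAlgebra ((Ideal.span {m : MvPolynomial (Fin n) k | ∃ b : Fin n →₀ ℕ, N ≤ Finsupp.weight w b ∧ m = MvPolynomial.monomial b 1}).map (Ideal.Quotient.mk (Ideal.span {f}))) (Ideal.Quotient.mk (Ideal.span {f}) (MvPolynomial.X v) ^ c)) (Ideal.Quotient.mk (Ideal.span {f}) (MvPolynomial.X v) ^ c) ∈ Q → ∀ d : ℕ, ringKrullDim (Localization.AtPrime Q) = d → ∀ s : Fin d → Localization.AtPrime Q, (Ideal.span (Set.range s)).radical.IsMaximal → RingTheory.Sequence.IsWeaklyRegular (Localization.AtPrime Q) (List.ofFn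 s) ∧ ∀ y : Localization.AtPrime Q, (∃ e : ℕ, y ^ p ^ e ∈ Ideal.span ((fun z : Localization.AtPrime Q => z ^ p ^ e) '' (Ideal.span (Set.range s) : Set (Localization.AtPrime Q)))) → y ∈ Ideal.span (Set.range s) := by
  intro p _ k _ _ n w v hv N c D hcN hc hsat f g hθf hg hXg _hfX hclg Q _ haQ
  -- the chart map `Θ`, the weight-`0̄` subalgebra `A`, and the identification `chart ring ≃+* A`
  have hΘex := WeightedChartMap.exists_chartMap k n w v c D f g hθf
  rcases hΘex with ⟨Θ, hΘ⟩
  have hAex := WeightZeroClauseDescent.exists_weightZeroSubalgebra k n (ZMod (w v))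
    (fun j : Fin n => if j = v then (1 : ZMod (w v)) else -((w j : ℕ) : ZMod (w v))) g
  rcases hAex with ⟨A, hA⟩
  have heex := exists_chartEquiv k n w v hv N c D hcN hc hsat f g hθf hg hXg Θ hΘ A hA
  rcases heex with ⟨e, -, hea⟩
  have hg0 : g ≠ 0 := fun h => hXg (h ▸ dvd_zero _)
  have hbN : Ideal.Quotient.mk (Ideal.span {g}) (MvPolynomial.X v) ^ N ∈ A := by
    rw [← hcN, mul_comm, pow_mul]
    exact A.pow_mem (WeightZeroClauseDescent.mk_X_pow_mem (w v) hA v) c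
  -- descent of the clause from `k[X]/(g)` to `A` at the maximal ideals containing `x_v^N`
  have hcore := WeightZeroClauseDescent.weightZero_clause_descent p k n (w v) hv _ g _ hg hg0 A hA
    (Ideal.Quotient.mk (Ideal.span {g}) (MvPolynomial.X v)) N hbN hclg
  -- transport along `e.symm : A ≃+* chart ring`, `x_v^N ↦ x_v^c`
  have hmarked : e.symm ⟨_, hbN⟩ = algebraMap (MvPolynomial (Fin n) k ⧸ Ideal.span {f}) _
      (Ideal.Quotient.mk (Ideal.span {f}) (MvPolynomial.X v) ^ c) := by
    rw [RingEquiv.symm_apply_eq]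
    exact Subtype.ext hea.symm
  exact E8Char5FiModel.clause_maximal_of_ringEquiv p e.symm ⟨_, hbN⟩ _ hmarked
    (fun Q' _ hQ' => hcore Q' hQ') Q haQ

end Summit.ResolutionOfSingularities.ResolutionOfSingularities.Theorems.FInjectiveMacaulayfication.WeightedChartClause

end
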